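import Literature.MathematicalPhysics.QuantumLattice.PairFieldSelectionRule
import HarnessLib

/-!
# Crux `JmPairBridge` (stmt-HubbardSuperconductivity-2226), line `Sketch` (Schur landing):
# the space group of the square torus is an admissible symmetry family

Route `JosephsonMirror`, crux `JmPairBridge`. The Schur landing of line `Sketch` reduces the crux to the
mirror's some-pair bridge plus IRREDUCIBILITY of the `(N_L, 0)` ground floor of `hubbardTorus 2 L 1 U` under
SOME family `S` of unitaries `X` with

  `Xᴴ X = 1`, `X H = H X`, `X (szSector N 0) ⊆ szSector N 0`, `X (szSector (N-2) 0) ⊆ szSector (N-2) 0`,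
  `X Δ_d = ω • Δ_d X` for a unimodular `ω`                                                    (PROPS)

(`everyFromSome_torus`, `jmPairBridge_of_interchange_of_irreducible`). This file makes the family concrete:
every space-group unitary `U_γ U_v = fockD4 γ * fockTranslate v` (`γ ∈ D₄`, `v` a torus translation) has
PROPS, with the phase `ω = χ_{B₁g}(γ)` (`spaceGroup_mul_pairField_dWave`); hence irreducibility of the floor
under the space group alone already supplies the `∃ S` clause of the residue
(`exists_symmetryFamily_of_spaceGroup_irreducible`).

Sources: D. J. Scalapino, Phys. Rep. 250 (1995) 329, §2 eq. (2.3) (`B₁g` covariance of `Δ_d`);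
O. Bratteli, D. W. Robinson, *Operator Algebras and Quantum Statistical Mechanics II* §5.2.2 (implementing
unitaries); J.-P. Serre, *Linear Representations of Finite Groups* §2.2. No definition, no named fact.
-/

noncomputable section

-- the mandated namespace `Summit.<Summit>.<Problem>.Theorems` repeats `HubbardSuperconductivity`
-- (single-problem summit, D-0017), which the `dupNamespace` linter flags on every declaration
set_option linter.dupNamespace false

namespace Summit.HubbardSuperconductivity.HubbardSuperconductivity.Theorems.JosephsonMirror

open Matrix Literature.MathematicalPhysics.QuantumLattice Literature.Probability.LatticeModels
open scoped ComplexOrder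

variable {L : ℕ} [NeZero L]

/-- `χ_{B₁g}(γ)` is unimodular: `‖χ_{B₁g}(γ)‖ = 1`. [folklore] -/
theorem norm_b1gChar (γ : DihedralGroup 4) : ‖b1gChar γ‖ = 1 := by
  have h := star_b1gChar_mul_self γ
  rw [Complex.star_def, Complex.conj_mul'] at h
  have h2 : ‖b1gChar γ‖ ^ 2 = 1 := by exact_mod_cast h
  have h0 : 0 ≤ ‖b1gChar γ‖ := norm_nonneg _
  nlinarith [h2, h0]

/-- The space-group unitary `U_γ U_v` is unitary: `(U_γ U_v)ᴴ (U_γ U_v) = 1`. [folklore] -/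
theorem conjTranspose_spaceGroup_mul_self (γ : DihedralGroup 4) (v : TorusSite 2 L) :
    ((fockD4 γ).val * (fockTranslate v).val)ᴴ *
        ((fockD4 γ).val * (fockTranslate v).val) = 1 := by
  -- each factor `U_π` is an isometry; stated over a generic linearly ordered orbital type, so that only
  -- ONE `DecidableEq` instance is in play, then transported (`convert` closes the instance mismatch)
  have hiso : ∀ {ι : Type} [LinearOrder ι] [Fintype ι] (π ρ : Equiv.Perm ι),
      ((fockRelabel π).val * (fockRelabel ρ).val)ᴴ * ((fockRelabel π).val * (fockRelabel ρ).val) = 1 := by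
    intro ι _ _ π ρ
    rw [conjTranspose_mul, Matrix.mul_assoc, ← Matrix.mul_assoc ((fockRelabel π).val)ᴴ, fockRelabel_val π,
      fockRelabel_conjTranspose_mul_self, Matrix.one_mul, fockRelabel_val ρ,
      fockRelabel_conjTranspose_mul_self]
  have h := hiso (Orb.d4Perm (L := L) γ) (Orb.translate v)
  rw [fockD4_apply]
  convert h

/-- **The space group is an admissible symmetry family (PROPS).** For every `γ ∈ D₄` and every torus
translation `v`, the unitary `X = U_γ U_v` on Fock space is unitary, commutes with `hubbardTorus 2 L 1 U`,
preserves every joint sector `szSector n 0`, and twists the `d`-wave pair field by the unimodular phase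
`χ_{B₁g}(γ)`: `X Δ_d = χ_{B₁g}(γ) • Δ_d X`. Scalapino (1995) §2 eq. (2.3). [folklore] -/
theorem spaceGroup_symmetryProps (γ : DihedralGroup 4) (v : TorusSite 2 L) (U : ℝ) (N : ℕ) :
    ((fockD4 γ).val * (fockTranslate v).val)ᴴ *
          ((fockD4 γ).val * (fockTranslate v).val) = 1 ∧
      ((fockD4 γ).val * (fockTranslate v).val) * hubbardTorus 2 L 1 U =
          hubbardTorus 2 L 1 U * ((fockD4 γ).val * (fockTranslate v).val) ∧
      (∀ w ∈ szSector N 0,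
          ((fockD4 γ).val * (fockTranslate v).val) *ᵥ w ∈ szSector N 0) ∧
      (∀ w ∈ szSector (N - 2) 0,
          ((fockD4 γ).val * (fockTranslate v).val) *ᵥ w ∈
            szSector (N - 2) 0) ∧
      ∃ ω : ℂ, ‖ω‖ = 1 ∧
        ((fockD4 γ).val * (fockTranslate v).val) * pairField dWaveFormFactor L =
          ω • (pairField dWaveFormFactor L * ((fockD4 γ).val * (fockTranslate v).val)) := by
  refine ⟨conjTranspose_spaceGroup_mul_self γ v, ?_, ?_, ?_, ⟨b1gChar γ, norm_b1gChar γ,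
    spaceGroup_mul_pairField_dWave γ v⟩⟩
  · -- both factors commute with `H`
    have h1 := (fockD4_commute_hubbardTorus (L := L) γ 1 U).eq
    have h2 := (fockTranslate_commute_hubbardTorus (d := 2) (L := L) v 1 U).eq
    rw [Matrix.mul_assoc, h2, ← Matrix.mul_assoc, h1, Matrix.mul_assoc]
  · intro w hw
    rw [← mulVec_mulVec]
    exact fockD4_mulVec_mem_szSector γ (fockTranslate_mulVec_mem_szSector v hw)
  · intro w hw
    rw [← mulVec_mulVec]
    exact fockD4_mulVec_mem_szSector γ (fockTranslate_mulVec_mem_szSector v hw)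

/-- **Space-group irreducibility supplies the symmetry family of the residue.** If a subspace `F` (the
`(N, 0)` ground floor) has no subspace other than `⊥` and `F` invariant under all space-group unitaries
`U_γ U_v`, then there is a family `S` of unitaries with PROPS under which `F` is irreducible — namely the
space group itself. [folklore] -/
theorem exists_symmetryFamily_of_spaceGroup_irreducible (U : ℝ) (N : ℕ)
    (F : Submodule ℂ (Fock (Orb (FermionTorus 2 L))))
    (hirr : ∀ K' : Submodule ℂ (Fock (Orb (FermionTorus 2 L))), K' ≤ F →
      (∀ (γ : DihedralGroup 4) (v : TorusSite 2 L), ∀ w ∈ K',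
        ((fockD4 γ).val * (fockTranslate v).val) *ᵥ w ∈ K') →
      K' = ⊥ ∨ K' = F) :
    ∃ S : Set (Matrix (Finset (Orb (FermionTorus 2 L))) (Finset (Orb (FermionTorus 2 L))) ℂ),
      (∀ X ∈ S, Xᴴ * X = 1 ∧ X * hubbardTorus 2 L 1 U = hubbardTorus 2 L 1 U * X ∧
        (∀ w ∈ szSector N 0, X *ᵥ w ∈ szSector N 0) ∧
        (∀ w ∈ szSector (N - 2) 0,
          X *ᵥ w ∈ szSector (N - 2) 0) ∧
        ∃ ω : ℂ, ‖ω‖ = 1 ∧ X * pairField dWaveFormFactor L = ω • (pairField dWaveFormFactor L * X)) ∧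
      ∀ K' : Submodule ℂ (Fock (Orb (FermionTorus 2 L))), K' ≤ F →
        (∀ X ∈ S, ∀ w ∈ K', X *ᵥ w ∈ K') → K' = ⊥ ∨ K' = F := by
  refine ⟨{X | ∃ (γ : DihedralGroup 4) (v : TorusSite 2 L),
      X = (fockD4 γ).val * (fockTranslate v).val}, ?_, ?_⟩
  · rintro X ⟨γ, v, rfl⟩
    exact spaceGroup_symmetryProps γ v U N
  · intro K' hK' hinv
    exact hirr K' hK' fun γ v w hw => hinv _ ⟨γ, v, rfl⟩ w hw

end Summit.HubbardSuperconductivity.HubbardSuperconductivity.Theorems.JosephsonMirror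

end
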